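import Summits.CriticalPhenomena.PercolationContinuityZ3.Theorems.SahiMasterFamilyThreePartitionTypedSliceCert
import HarnessLib

/-!
# The ZERO-NESTED step of twisted three-partition positivity at COMB level (unit `prim-master-conj`, gen 34;
# `--supports stmt-CriticalPhenomena-4575`)

Memo `run/shared/lean/prim/prim-l12/prim-master-conj/POINTWISE.md` §34 (V3), §35.  At a coordinate `e` with sections
`𝒳⁰ = {T | T ∖ e ∈ 𝒳}`, `𝒳¹ = {T | T ∪ e ∈ 𝒳}` (lifted `e`-free to `ι`), for up-sets `𝒰, 𝒱, 𝒲` and a twist `τ`: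
ZERO-NESTED (`threePartNT_nonneg_of_zeroNested`): if `𝒰⁰ ⊆ 𝒱⁰ ∩ 𝒲⁰` and the contraction minor `(𝒰¹,𝒱¹,𝒲¹)` has `N_τ ≥ 0`, then
`N_τ(𝒰,𝒱,𝒲) ≥ 0` (certificates `KLIH:k1/k2:P0<=P1&P0<=P2` of gen 33: six typed Kleitman atoms + the contraction minor, multipliers
`1`/`2`; kernel-checked through `…TypedSliceCert`).  The single inclusion `𝒰⁰ ⊆ 𝒱⁰` is NOT certifiable by the bank (pseudo-count,
POINTWISE §34 (V3)).  No `sorry`, standard axioms, nothing conditional beyond the displayed IH hypothesis.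
HONEST LABEL: a class STEP, not three-partition positivity. [this work]
-/

noncomputable section

open Finset
open scoped symmDiff Classical

namespace Summit.CriticalPhenomena.PercolationContinuityZ3.Theorems.ThreePartition

namespace TypedSlice

variable {ι : Type*}

/-! ## The ZeroNested step -/

section ZeroNested

/-- Atoms (multiplier, atom) of certificate `KLIH:k1:P0<=P1&P0<=P2` (scaled by `1`). [this work] -/
def zeroNestedAL : List (ℕ × Atom) :=
  [(1, .kl (some (mk 0 0 1)) 117670336 134217216),
   (1, .kl (some (mk 0 1 0)) 115043766 134217216),
   (1, .kl (some (mk 0 1 1)) 115043766 134217216),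
   (1, .kl (some (mk 1 0 1)) 132379128 134217216),
   (1, .kl (some (mk 1 1 0)) 115043766 134217216),
   (1, .kl (some (mk 1 1 1)) 115043766 134217216)]
/-- IH triples (multiplier, thresholds) of certificate `KLIH:k1:P0<=P1&P0<=P2` (scaled by `1`). [this work] -/
def zeroNestedAI : List (ℕ × Ty × Ty × Ty) :=
  [(1, mk 0 0 1, mk 0 1 0, mk 1 0 0)]

/-- Atoms (multiplier, atom) of certificate `KLIH:k2:P0<=P1&P0<=P2` (scaled by `1`). [this work] -/
def zeroNestedBL : List (ℕ × Atom) :=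
  [(1, .kl (some (mk 0 0 1)) 132379128 134217216),
   (1, .kl (some (mk 0 1 0)) 115043766 134217216),
   (1, .kl (some (mk 0 1 1)) 115043766 134217216),
   (1, .kl (some (mk 1 0 1)) 132379128 134217216),
   (1, .kl (some (mk 1 1 0)) 115043766 134217216),
   (1, .kl (some (mk 1 1 1)) 115043766 134217216)]
/-- IH triples (multiplier, thresholds) of certificate `KLIH:k2:P0<=P1&P0<=P2` (scaled by `1`). [this work] -/
def zeroNestedBI : List (ℕ × Ty × Ty × Ty) :=
  [(2, mk 0 0 1, mk 0 1 0, mk 1 0 0)]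

/-- The ZERO-NESTED class `U⁰ ⊆ V⁰ ∩ W⁰` (the deletion section of one member inside the other two) on types. [this work] -/
def clsZeroNested (t : Ty) : Bool := !decide (t.1 = 2) || (decide (t.2.1 = 2) && decide (t.2.2 = 2))

/-- Side conditions of certificate (k1). [this work] -/
theorem zeroNestedA_ok : certOK zeroNestedAL = true := by
  decide +kernel

/-- Side conditions of certificate (k2). [this work] -/
theorem zeroNestedB_ok : certOK zeroNestedBL = true := by
  decide +kernel

/-- **Certificate (k1) is valid** (`e ∉ τ`; kernel computation over the sorted class triples). [this work] -/
theorem zeroNestedA_check : check clsZeroNested (certResid false 1 zeroNestedAL zeroNestedAI) = true := by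
  decide +kernel

/-- **Certificate (k2) is valid** (`e ∈ τ`; kernel computation over the sorted class triples). [this work] -/
theorem zeroNestedB_check : check clsZeroNested (certResid true 1 zeroNestedBL zeroNestedBI) = true := by
  decide +kernel

variable [Fintype ι] {𝒰 𝒱 𝒲 : Set (Set ι)} (e : ι) (τ : Set ι)

omit [Fintype ι] in
/-- Under the structural hypothesis every realised type is in the class. [this work] -/
theorem clsZeroNested_typ
    (hzn : ∀ T : Set ι, T \ {e} ∈ 𝒰 → T \ {e} ∈ 𝒱 ∧ T \ {e} ∈ 𝒲) (w : Set ι) :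
    clsZeroNested (typ 𝒰 𝒱 𝒲 e w) = true := by
  have hU := tyAt_eq_two_iff 𝒰 e w
  have hV := tyAt_eq_two_iff 𝒱 e w
  have hW := tyAt_eq_two_iff 𝒲 e w
  simp only [clsZeroNested, typ, Bool.or_eq_true, Bool.not_eq_eq_eq_not, Bool.not_true, decide_eq_false_iff_not,
    Bool.and_eq_true, decide_eq_true_eq, hU, hV, hW]
  by_cases h : w \ {e} ∈ 𝒰
  · exact Or.inr (hzn w h)
  · exact Or.inl h

/-- **THE ZERONESTED STEP.**  If at the coordinate `e` the triple of up-sets `(𝒰, 𝒱, 𝒲)` is in the ZERO-NESTED class `U⁰ ⊆ V⁰ ∩ W⁰` (the deletion section of one member inside the other two),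
and the `e`-free section triples it needs have nonnegative twisted functional at `τ` (`N_τ(𝒲¹, 𝒱¹, 𝒰¹) ≥ 0`; here `𝒳⁰ = {T | T ∖ e ∈ 𝒳}`,
`𝒳¹ = {T | T ∪ e ∈ 𝒳}`, written as threshold families `thrSet`, see `mem_thrSet`), then `threePartNT τ 𝒰 𝒱 𝒲 ≥ 0`.
Certificates of POINTWISE §34 (V3)/(V4) (`KLIH:k1:P0<=P1&P0<=P2` scaled by `1`, `KLIH:k2:P0<=P1&P0<=P2` scaled by `1`), kernel-checked. [this work] -/
theorem threePartNT_nonneg_of_zeroNested (h𝒰 : IsUpperSet 𝒰) (h𝒱 : IsUpperSet 𝒱) (h𝒲 : IsUpperSet 𝒲)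
    (hzn : ∀ T : Set ι, T \ {e} ∈ 𝒰 → T \ {e} ∈ 𝒱 ∧ T \ {e} ∈ 𝒲)
    (hN1 : 0 ≤ threePartNT τ (thrSet 𝒰 𝒱 𝒲 e (mk 0 0 1)) (thrSet 𝒰 𝒱 𝒲 e (mk 0 1 0)) (thrSet 𝒰 𝒱 𝒲 e (mk 1 0 0))) :
    0 ≤ threePartNT τ 𝒰 𝒱 𝒲 := by
  by_cases he : e ∈ τ
  · refine threePartNT_nonneg_of_cert 𝒰 𝒱 𝒲 e τ h𝒰 h𝒱 h𝒲 (d := 1) (by norm_num) (L := zeroNestedBL) (I := zeroNestedBI)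
      (cls := clsZeroNested) zeroNestedB_ok ?_ (clsZeroNested_typ e  hzn) ?_
    · rw [decide_eq_true he]; exact zeroNestedB_check
    · intro p hp
      simp only [zeroNestedBI, List.mem_singleton] at hp
      subst hp
      exact hN1
  · refine threePartNT_nonneg_of_cert 𝒰 𝒱 𝒲 e τ h𝒰 h𝒱 h𝒲 (d := 1) (by norm_num) (L := zeroNestedAL) (I := zeroNestedAI)
      (cls := clsZeroNested) zeroNestedA_ok ?_ (clsZeroNested_typ e  hzn) ?_
    · rw [decide_eq_false he]; exact zeroNestedA_check
    · intro p hp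
      simp only [zeroNestedAI, List.mem_singleton] at hp
      subst hp
      exact hN1

end ZeroNested

end TypedSlice

end Summit.CriticalPhenomena.PercolationContinuityZ3.Theorems.ThreePartition
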